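import Summits.ABC.StewartYu.ArchG3RecLinesC
import HarnessLib

/-!
# The archimedean record `ArchG3Rec` — letter lines in closed form, file D: THE JETS RADIUS (sorted weights) and `cUR`

Support file (theorems only; no named facts). Cell `abc-stewartyu`, route `YuMatveevShapeRat`, crux r2 `ArchCoreRat`
(stmt-ABC-20502), line `arch-g3-frame`, seam (B) of `stub_recLinesArch` (p5's closed letters of `ArchG3RecLinesClosed`).
WITH SORTED WEIGHTS (`Monotone P.A`, the shaped frame's letter; pivot = last index): `AθR k ≤ n·A k`,
`AθR k·sRR k ≤ 3·n·n!·N·L`, `AθR k·btR k ≤ (3/2)·n·n!·N·Bexp·Alast` (the pairing `(Σ_{j≤k}A j)(Σ_{j>k} 1/A j) ≤ n(n−1)` kills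
the weights), `0 ≤ yR lev ≤ 6n²n!NL/2^lev + 8n²n!·Bexp·N²·L`, `T lev ≥ 8L/2^{lev+1}`, and the Cauchy radius `1 ≤ CR lev`,
`log(2·CR lev) ≤ log 2 + log(1 + (7/2)·n²·n!·Bexp·N²·2^lev)` (NO `log L`: the `L` of `yR` cancels against `T`).  Without
`Monotone A` the jets radius carries `Ω·L` (weights `A = (Ω, 1, …, 1)`) and the jets line is false for `log Ω ≫ cⁿ`; hence
`linesClosed_holds` takes the sorted-weights letter as a hypothesis.  Also `cUR ≤ Z/(4·yload_K) + 1 + n·(WN + L/2^21 + 1)`.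

## References
* [Nesterenko2003] Yu. V. Nesterenko, LNM 1819 (2003) — §3.5 (3.22)–(3.25); §4.2 Lemma 4.3, (4.22).
-/

noncomputable section

open Finset Real
open scoped Nat

namespace Summit.ABC.StewartYu

namespace ArchG3Rec

open PadicG3Par (Cb Cb_pos)
open ArchG3Par (G K yloadK G_eq G_pos K_pos yloadK_pos)

variable {n : ℕ} (P : ArchG3Rec n)

/-! ### With sorted weights -/

/-- sorted weights: `AθR k ≤ n·A k`, `0 ≤ AθR k`, and `AθR k·Σ_{j>k} 1/A j ≤ n·(n−1)`. [folklore] -/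
theorem AθR_le (hmono : Monotone P.A) (k : Fin n) : P.AθR k ≤ n * P.A k ∧ 0 ≤ P.AθR k ∧
    P.AθR k * ∑ j ∈ Ioi k, 1 / P.A j ≤ n * (n - 1) := by
  have hA := P.A_facts
  have h1 : P.AθR k ≤ n * P.A k := by
    unfold AθR
    calc ∑ j ∈ Iic k, P.A j ≤ ∑ _j ∈ Iic k, P.A k := sum_le_sum fun j hj => hmono (mem_Iic.mp hj)
      _ = (Iic k).card * P.A k := by rw [sum_const, nsmul_eq_mul]
      _ ≤ n * P.A k := by
          apply mul_le_mul_of_nonneg_right _ (hA k).1.le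
          exact_mod_cast (card_le_univ (Iic k)).trans (by simp)
  have h0 : 0 ≤ P.AθR k := by unfold AθR; exact sum_nonneg fun j _ => (hA j).1.le
  refine ⟨h1, h0, ?_⟩
  -- `A k/A j ≤ 1` for `j > k`
  have h2 : P.A k * ∑ j ∈ Ioi k, 1 / P.A j ≤ n - 1 := by
    rw [mul_sum]
    have hcard : (Ioi k).card ≤ n - 1 := by
      have : (Ioi k).card < n := by
        have : (Ioi k).card < (univ : Finset (Fin n)).card :=
          card_lt_card (ssubset_of_subset_of_ne (subset_univ _) fun h' => by
            have : k ∈ Ioi k := by rw [h']; exact mem_univ _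
            simp at this)
        simpa using this
      omega
    calc ∑ j ∈ Ioi k, P.A k * (1 / P.A j) ≤ ∑ _j ∈ Ioi k, (1 : ℝ) :=
          sum_le_sum fun j hj => by
            rw [mul_one_div, div_le_one (hA j).1]; exact hmono (mem_Ioi.mp hj).le
      _ = (Ioi k).card := by simp
      _ ≤ ((n - 1 : ℕ) : ℝ) := by exact_mod_cast hcard
      _ = n - 1 := by rw [Nat.cast_sub P.hn]; simp
  have hs0 : 0 ≤ ∑ j ∈ Ioi k, 1 / P.A j := sum_nonneg fun j _ => by have := (hA j).1; positivity
  have hn0 : (0 : ℝ) ≤ n := Nat.cast_nonneg n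
  calc P.AθR k * ∑ j ∈ Ioi k, 1 / P.A j ≤ (n * P.A k) * ∑ j ∈ Ioi k, 1 / P.A j := mul_le_mul_of_nonneg_right h1 hs0
    _ = n * (P.A k * ∑ j ∈ Ioi k, 1 / P.A j) := by ring
    _ ≤ n * (n - 1) := mul_le_mul_of_nonneg_left h2 hn0

/-- **sorted weights: `AθR k·sRR k ≤ 3·n·n!·N·L`** (the pairing `(Σ_{j≤k}A j)(Σ_{j>k}(2Bv j+1)) ≤ (3/2)NL·n(n−1)` kills the weights). [folklore] -/
theorem AθR_sRR_le (hmono : Monotone P.A) (k : Fin n) : P.AθR k * P.sRR k ≤ 3 * n * n ! * (P.N * P.L) := by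
  obtain ⟨h1, h0, h2⟩ := P.AθR_le hmono k
  obtain ⟨hf, hf1⟩ := fact_pred_le P.hn
  have hA := P.A_facts
  have hN := P.N_facts.1
  have hNL : 0 ≤ P.N * (P.L : ℝ) := by positivity
  have hb := fun j => (P.box_le j).1
  have hAk := (P.box_le k).2.1
  -- `AθR·Σ_{j>k}(2Bv j+1) ≤ (3/2)NL·AθR·Σ 1/A j ≤ (3/2) NL n (n−1)`
  have hS : P.AθR k * ∑ j ∈ Ioi k, (2 * (P.Bv j : ℝ) + 1) ≤ 3 / 2 * (P.N * P.L) * (n * (n - 1)) := by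
    calc P.AθR k * ∑ j ∈ Ioi k, (2 * (P.Bv j : ℝ) + 1) ≤ P.AθR k * ∑ j ∈ Ioi k, 3 / 2 * (P.N * P.L) / P.A j :=
          mul_le_mul_of_nonneg_left (sum_le_sum fun j _ => hb j) h0
      _ = 3 / 2 * (P.N * P.L) * (P.AθR k * ∑ j ∈ Ioi k, 1 / P.A j) := by
          rw [mul_sum, mul_sum, mul_sum]; refine sum_congr rfl fun j _ => ?_; ring
      _ ≤ 3 / 2 * (P.N * P.L) * (n * (n - 1)) := mul_le_mul_of_nonneg_left h2 (by positivity)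
  -- `AθR·(2Bv k+1) ≤ n A k·(3/2)NL/A k = (3/2) n NL`
  have hAk0 : P.A k ≠ 0 := (hA k).1.ne'
  have hK : P.AθR k * (2 * (P.Bv k : ℝ) + 1) ≤ 3 / 2 * n * (P.N * P.L) := by
    calc P.AθR k * (2 * (P.Bv k : ℝ) + 1) ≤ (n * P.A k) * (3 / 2 * (P.N * P.L) / P.A k) :=
          mul_le_mul h1 (hb k) (by positivity) (by have := (hA k).1; positivity)
      _ = 3 / 2 * n * (P.N * P.L) := by field_simp
  -- `AθR·2 ≤ 2 n A k ≤ n NL`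
  have hn0 : (0 : ℝ) ≤ n := Nat.cast_nonneg n
  have h2' : P.AθR k * 2 ≤ n * (P.N * P.L) := by nlinarith
  unfold sRR; push_cast
  have hf0 : (0 : ℝ) ≤ ((n - 1)! : ℕ) := Nat.cast_nonneg _
  have e : P.AθR k * ((((n - 1)! : ℕ) : ℝ) * ∑ j ∈ Ioi k, (2 * (P.Bv j : ℝ) + 1) + (2 * (P.Bv k : ℝ) + 1) + 2) =
      (((n - 1)! : ℕ) : ℝ) * (P.AθR k * ∑ j ∈ Ioi k, (2 * (P.Bv j : ℝ) + 1)) + P.AθR k * (2 * (P.Bv k : ℝ) + 1) + P.AθR k * 2 := by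
    ring
  rw [e]
  have h3 : (((n - 1)! : ℕ) : ℝ) * (P.AθR k * ∑ j ∈ Ioi k, (2 * (P.Bv j : ℝ) + 1)) ≤
      (((n - 1)! : ℕ) : ℝ) * (3 / 2 * (P.N * P.L) * (n * (n - 1))) := mul_le_mul_of_nonneg_left hS hf0
  -- `(n-1)!·n(n−1) ≤ n·n! − n` (from `(n−1)!(n−1) + 1 ≤ n!`)
  have h4 : (((n - 1)! : ℕ) : ℝ) * (n * (n - 1)) ≤ (n : ℝ) * (n ! : ℝ) - n := by nlinarith [mul_le_mul_of_nonneg_left hf hn0]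
  have h5 : (((n - 1)! : ℕ) : ℝ) * (3 / 2 * (P.N * P.L) * (n * (n - 1))) ≤ 3 / 2 * (P.N * P.L) * ((n : ℝ) * (n ! : ℝ) - n) := by
    have := mul_le_mul_of_nonneg_left h4 (show (0:ℝ) ≤ 3 / 2 * (P.N * P.L) by positivity)
    linarith [this]
  have hf1' : (1 : ℝ) ≤ n ! := by exact_mod_cast Nat.one_le_iff_ne_zero.mpr (Nat.factorial_ne_zero n)
  have h6 : (n : ℝ) * (P.N * P.L) ≤ n * n ! * (P.N * P.L) := by
    have := mul_le_mul_of_nonneg_left hf1' (show (0:ℝ) ≤ n * (P.N * P.L) by positivity)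
    linarith [this]
  linarith

/-- **sorted weights: `AθR k·btR k ≤ (3/2)·n·n!·N·Bexp·Alast`**. [folklore] -/
theorem AθR_btR_le (hmono : Monotone P.A) (k : Fin n) : P.AθR k * P.btR k ≤ 3 / 2 * n * n ! * P.N * P.Bexp * P.Alast := by
  obtain ⟨h1, h0, h2⟩ := P.AθR_le hmono k
  obtain ⟨hf, hf1⟩ := fact_pred_le P.hn
  obtain ⟨hAl1, -, -, -, -, hB1⟩ := P.Alast_facts
  have hA := P.A_facts k
  have hN := P.N_facts.1
  have hc : 0 ≤ P.N * P.Bexp * P.Alast := by positivity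
  have hf0 : (0 : ℝ) ≤ ((n - 1)! : ℕ) := Nat.cast_nonneg _
  unfold btR
  have e : P.AθR k * ((((n - 1)! : ℕ) : ℝ) * P.N * P.Bexp * P.Alast * ∑ j ∈ Ioi k, 1 / P.A j + P.N * P.Bexp * P.Alast / P.A k) =
      (P.N * P.Bexp * P.Alast) * ((((n - 1)! : ℕ) : ℝ) * (P.AθR k * ∑ j ∈ Ioi k, 1 / P.A j) + P.AθR k / P.A k) := by ring
  rw [e]
  have h3 : P.AθR k / P.A k ≤ n := by rw [div_le_iff₀ hA.1]; exact h1
  have h4 : (((n - 1)! : ℕ) : ℝ) * (P.AθR k * ∑ j ∈ Ioi k, 1 / P.A j) + P.AθR k / P.A k ≤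
      (((n - 1)! : ℕ) : ℝ) * (n * (n - 1)) + n := by gcongr
  have hn1 : (1 : ℝ) ≤ n := by exact_mod_cast P.hn
  have hfn : (1 : ℝ) ≤ n ! := by exact_mod_cast Nat.one_le_iff_ne_zero.mpr (Nat.factorial_ne_zero n)
  -- `(n−1)!·n(n−1) + n ≤ n·n! + n ≤ (3/2) n n!`… using `(n-1)!(n-1)+1 ≤ n!`: `(n-1)! n (n-1) + n = n((n-1)!(n-1) + 1) ≤ n·n!`
  have h5 : (((n - 1)! : ℕ) : ℝ) * (n * (n - 1)) + n ≤ n * n ! := by nlinarith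
  have hx : 0 ≤ (n : ℝ) * n ! * (P.N * P.Bexp * P.Alast) := mul_nonneg (by positivity) hc
  calc (P.N * P.Bexp * P.Alast) * ((((n - 1)! : ℕ) : ℝ) * (P.AθR k * ∑ j ∈ Ioi k, 1 / P.A j) + P.AθR k / P.A k)
      ≤ (P.N * P.Bexp * P.Alast) * (n * n !) := mul_le_mul_of_nonneg_left (h4.trans h5) hc
    _ = n * n ! * (P.N * P.Bexp * P.Alast) := by ring
    _ ≤ 3 / 2 * n * n ! * P.N * P.Bexp * P.Alast := by linarith [hx]

/-- **sorted weights: the jets scalar `0 ≤ yR lev ≤ 14·n²·n!·Bexp·N²·L`** and, with `LbR lev ≤ 2sRR/2^lev`, the level form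
`yR lev ≤ 6·n²·n!·N·L/2^lev + 8·n²·n!·Bexp·N²·L`… stated as the pair used by `CR`. [cite: Nesterenko2003, §4.2 Lemma 4.3; shape only] -/
theorem yR_le (hmono : Monotone P.A) (lev : ℕ) : 0 ≤ P.yR lev ∧
    P.yR lev ≤ 6 * n ^ 2 * n ! * (P.N * P.L) / 2 ^ lev + 8 * n ^ 2 * n ! * P.Bexp * P.N ^ 2 * P.L := by
  obtain ⟨hAl1, -, hAl2, -, hjl, hB1⟩ := P.Alast_facts
  have hN := P.N_facts
  have hL := P.L_real
  have hterm : ∀ k, 0 ≤ P.AθR k * P.ΓR lev k ∧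
      P.AθR k * P.ΓR lev k ≤ 6 * n * n ! * (P.N * P.L) / 2 ^ lev + 8 * n * n ! * P.Bexp * P.N ^ 2 * P.L := by
    intro k
    obtain ⟨-, h0, -⟩ := P.AθR_le hmono k
    obtain ⟨hLb1, -, -, hLb0⟩ := P.LbR_le lev k
    obtain ⟨hbt0, -⟩ := P.btR_le k
    have hS := P.AθR_sRR_le hmono k
    have hB := P.AθR_btR_le hmono k
    have hΓ0 : 0 ≤ P.ΓR lev k := by unfold ΓR; positivity
    refine ⟨mul_nonneg h0 hΓ0, ?_⟩
    unfold ΓR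
    -- `AθR·LbR ≤ 2·AθR·sRR/2^lev ≤ 6 n n! NL/2^lev`
    have h1 : P.AθR k * (P.LbR lev k : ℝ) ≤ 6 * n * n ! * (P.N * P.L) / 2 ^ lev := by
      calc P.AθR k * (P.LbR lev k : ℝ) ≤ P.AθR k * (2 * (P.sRR k : ℝ) / 2 ^ lev) := mul_le_mul_of_nonneg_left hLb1 h0
        _ = 2 * (P.AθR k * P.sRR k) / 2 ^ lev := by ring
        _ ≤ 2 * (3 * n * n ! * (P.N * P.L)) / 2 ^ lev := by gcongr
        _ = 6 * n * n ! * (P.N * P.L) / 2 ^ lev := by ring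
    -- `AθR·2btR·((2Bv jl+1)/N + 2) ≤ 2·(3/2) n n! N B Alast·((3/2)L/Alast + 2) = 3 n n! N B((3/2)L + 2Alast) ≤ 8 n n! B N² L`
    have h2 : P.AθR k * (2 * P.btR k * ((2 * P.Bv P.jl + 1 : ℝ) / P.N + 2)) ≤ 8 * n * n ! * P.Bexp * P.N ^ 2 * P.L := by
      have e : P.AθR k * (2 * P.btR k * ((2 * P.Bv P.jl + 1 : ℝ) / P.N + 2)) =
          2 * (P.AθR k * P.btR k) * ((2 * P.Bv P.jl + 1 : ℝ) / P.N + 2) := by ring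
      rw [e]
      have hBA : 0 ≤ P.Bexp := by linarith
      have hAl0 : 0 < P.Alast := by linarith
      have hAlne : P.Alast ≠ 0 := hAl0.ne'
      have hcoef : 0 ≤ 3 * (n : ℝ) * n ! * P.N * P.Bexp := by positivity
      have hj0 : 0 ≤ (2 * P.Bv P.jl + 1 : ℝ) / P.N + 2 := by positivity
      calc 2 * (P.AθR k * P.btR k) * ((2 * P.Bv P.jl + 1 : ℝ) / P.N + 2)
          ≤ 2 * (3 / 2 * n * n ! * P.N * P.Bexp * P.Alast) * (3 / 2 * P.L / P.Alast + 2) :=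
            mul_le_mul (by linarith) hjl hj0 (by positivity)
        _ = 3 * n * n ! * P.N * P.Bexp * (3 / 2 * P.L + 2 * P.Alast) := by field_simp
        _ ≤ 3 * n * n ! * P.N * P.Bexp * (3 / 2 * P.L + P.N * P.L) :=
            mul_le_mul_of_nonneg_left (by linarith) hcoef
        _ ≤ 8 * n * n ! * P.Bexp * P.N ^ 2 * P.L := by
            have hL1 : (P.L : ℝ) ≤ P.N * (P.L : ℝ) := by nlinarith
            have := mul_le_mul_of_nonneg_left hL1 hcoef
            nlinarith [this]
    linarith
  refine ⟨by unfold yR; exact sum_nonneg fun k _ => (hterm k).1, ?_⟩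
  unfold yR
  calc ∑ k, P.AθR k * P.ΓR lev k ≤ ∑ _k : Fin n, (6 * n * n ! * (P.N * P.L) / 2 ^ lev + 8 * n * n ! * P.Bexp * P.N ^ 2 * P.L) :=
        sum_le_sum fun k _ => (hterm k).2
    _ = 6 * n ^ 2 * n ! * (P.N * P.L) / 2 ^ lev + 8 * n ^ 2 * n ! * P.Bexp * P.N ^ 2 * P.L := by simp; ring

/-- `T lev ≥ 8L/2^{lev+1}` (real): `T = max(1, ⌊8L/2^lev⌋) ≥ max(1, 8L/2^lev − 1)`. [folklore] -/
theorem T_ge_half (lev : ℕ) : 8 * (P.L : ℝ) / 2 ^ (lev + 1) ≤ P.T lev ∧ (1 : ℝ) ≤ P.T lev := by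
  have h1 := P.T_add_one_gt lev
  have h2 : (1 : ℝ) ≤ P.T lev := by exact_mod_cast (P.T_facts lev).1
  refine ⟨?_, h2⟩
  have e : 8 * (P.L : ℝ) / 2 ^ (lev + 1) = (8 * (P.L : ℝ) / 2 ^ lev) / 2 := by rw [pow_succ]; ring
  rw [e]; linarith

/-- **sorted weights: the Cauchy radius** `1 ≤ CR lev` and `log(2·CR lev) ≤ log 2 + log(1 + (7/2)·n²·n!·Bexp·N²·2^lev)`
(`yR/T` with `T ≥ 8L/2^{lev+1}`: the `L` cancels — no `log L`). [folklore] -/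
theorem log_CR_le (hmono : Monotone P.A) (lev : ℕ) : 1 ≤ P.CR lev ∧
    Real.log (2 * P.CR lev) ≤ Real.log 2 + Real.log (1 + 7 / 2 * n ^ 2 * n ! * P.Bexp * P.N ^ 2 * 2 ^ lev) := by
  obtain ⟨hy0, hy⟩ := P.yR_le hmono lev
  obtain ⟨hT, hT1⟩ := P.T_ge_half lev
  have hB1 := P.Alast_facts.2.2.2.2.2
  have hN := P.N_facts
  have hL := P.L_real
  have h1 : 1 ≤ P.CR lev := le_max_left _ _
  refine ⟨h1, ?_⟩
  -- `yR/T ≤ yR·2^{lev+1}/(8L) ≤ (3/2) n² n! N + 2 n² n! B N² 2^lev ≤ (7/2) n² n! B N² 2^lev`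
  have hq : P.yR lev / P.T lev ≤ 7 / 2 * n ^ 2 * n ! * P.Bexp * P.N ^ 2 * 2 ^ lev := by
    rw [div_le_iff₀ (by linarith)]
    have h2l : (0 : ℝ) < 2 ^ lev := by positivity
    have e1 : 6 * (n : ℝ) ^ 2 * n ! * (P.N * P.L) / 2 ^ lev = (6 * n ^ 2 * n ! * P.N) * ((P.L : ℝ) / 2 ^ lev) := by ring
    have hTL : (P.L : ℝ) / 2 ^ lev ≤ P.T lev / 4 := by
      rw [pow_succ] at hT
      rw [div_le_iff₀ h2l]
      have := (div_le_iff₀ (by positivity : (0:ℝ) < 2 ^ lev * 2)).mp hT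
      linarith
    have hTL2 : (P.L : ℝ) ≤ P.T lev / 4 * 2 ^ lev := by rwa [div_le_iff₀ h2l] at hTL
    have hc1 : 0 ≤ 6 * n ^ 2 * n ! * (P.N : ℝ) := by positivity
    have hc2 : 0 ≤ 8 * n ^ 2 * n ! * P.Bexp * (P.N : ℝ) ^ 2 := by positivity
    have hN1 : (P.N : ℝ) ≤ P.N ^ 2 := by nlinarith
    calc P.yR lev ≤ (6 * n ^ 2 * n ! * P.N) * ((P.L : ℝ) / 2 ^ lev) + (8 * n ^ 2 * n ! * P.Bexp * P.N ^ 2) * (P.L : ℝ) := by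
            rw [← e1]; linarith
      _ ≤ (6 * n ^ 2 * n ! * P.N) * (P.T lev / 4) + (8 * n ^ 2 * n ! * P.Bexp * P.N ^ 2) * (P.T lev / 4 * 2 ^ lev) := by
          have hBA : 0 ≤ P.Bexp := by linarith
          gcongr
      _ ≤ 7 / 2 * n ^ 2 * n ! * P.Bexp * P.N ^ 2 * 2 ^ lev * P.T lev := by
          have h2l1 : (1 : ℝ) ≤ 2 ^ lev := one_le_pow₀ (by norm_num)
          have hT0 : (0 : ℝ) ≤ P.T lev := by linarith
          have : (6 * n ^ 2 * n ! * (P.N : ℝ)) ≤ 6 * n ^ 2 * n ! * P.Bexp * P.N ^ 2 * 2 ^ lev := by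
            have hc3 : (0 : ℝ) ≤ 6 * n ^ 2 * n ! := by positivity
            calc (6 * n ^ 2 * n ! * (P.N : ℝ)) = 6 * n ^ 2 * n ! * 1 * P.N * 1 := by ring
              _ ≤ 6 * n ^ 2 * n ! * P.Bexp * P.N ^ 2 * 2 ^ lev := by gcongr
          nlinarith
  have hCR : P.CR lev ≤ 1 + 7 / 2 * n ^ 2 * n ! * P.Bexp * P.N ^ 2 * 2 ^ lev := by
    unfold CR
    exact max_le (by have : (0:ℝ) ≤ 7 / 2 * n ^ 2 * n ! * P.Bexp * P.N ^ 2 * 2 ^ lev := by positivity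
                     linarith) (by linarith)
  have hpos : 0 < P.CR lev := by linarith
  rw [Real.log_mul (by norm_num) hpos.ne']
  gcongr

/-! ### The unknowns -/

/-- **`cUR ≤ Z/(4·yload_K) + 1 + n·(WN + L/2^21 + 1)`** (`log(L₀+1) ≤ L₀`, `log(2Bv j + 2) ≤ log N + log L + 1`). [folklore] -/
theorem cUR_le : P.cUR ≤ P.Z / (4 * yloadK n) + 1 + n * (P.WN + P.L / 2 ^ 21 + 1) ∧ 0 ≤ P.cUR := by
  obtain ⟨-, -, hL0⟩ := P.L₀_real_le
  obtain ⟨hlogL, -, hlogN, hlogL0, -⟩ := P.log_letters_le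
  have hN := P.N_facts
  have hL := P.L_real
  have hb := fun j => (P.box_le j).2.2.1
  have h1 : Real.log (P.L₀ + 1 : ℝ) ≤ P.L₀ := by
    have := Real.add_one_le_exp (P.L₀ : ℝ)
    have h0 : (0 : ℝ) < P.L₀ + 1 := by positivity
    calc Real.log (P.L₀ + 1 : ℝ) ≤ Real.log (Real.exp P.L₀) := Real.log_le_log h0 this
      _ = P.L₀ := Real.log_exp _
  -- `2Bv j + 2 ≤ (3/2) N L + 1 ≤ e·N·L` hence `log ≤ 1 + log N + log L`
  have h2 : ∀ j, Real.log (2 * P.Bv j + 2 : ℝ) ≤ P.WN + P.L / 2 ^ 21 + 1 := by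
    intro j
    have h4p : (4 : ℝ) ≤ 2 ^ (n + 25) := le_trans (by norm_num) (pow_le_pow_right₀ (by norm_num) (by omega : 2 ≤ n + 25))
    have hNL : (4 : ℝ) ≤ P.N * P.L := by nlinarith [hL.2.2.1, hN.2.1]
    have he : (2.7 : ℝ) ≤ Real.exp 1 := by have := Real.exp_one_gt_d9; linarith
    have h3 : (2 * P.Bv j + 2 : ℝ) ≤ Real.exp 1 * (P.N * P.L) := by have := hb j; nlinarith
    have h4 : Real.log (2 * P.Bv j + 2 : ℝ) ≤ Real.log (Real.exp 1 * (P.N * P.L)) :=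
      Real.log_le_log (by positivity) h3
    rw [Real.log_mul (Real.exp_pos 1).ne' (by positivity), Real.log_exp, Real.log_mul hN.1.ne' hL.2.1.ne'] at h4
    linarith
  have h5 : ∑ j, Real.log (2 * P.Bv j + 2 : ℝ) ≤ n * (P.WN + P.L / 2 ^ 21 + 1) := by
    calc ∑ j, Real.log (2 * P.Bv j + 2 : ℝ) ≤ ∑ _j : Fin n, (P.WN + P.L / 2 ^ 21 + 1) := sum_le_sum fun j _ => h2 j
      _ = n * (P.WN + P.L / 2 ^ 21 + 1) := by rw [sum_const, card_univ, Fintype.card_fin, nsmul_eq_mul]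
  have h6 : 0 ≤ ∑ j, Real.log (2 * P.Bv j + 2 : ℝ) :=
    sum_nonneg fun j _ => Real.log_nonneg (by have := (P.Bv_real j).1; linarith)
  refine ⟨?_, ?_⟩
  · unfold cUR; linarith
  · unfold cUR
    have : 0 ≤ Real.log (P.L₀ + 1 : ℝ) := Real.log_nonneg (by have : (0:ℝ) ≤ P.L₀ := Nat.cast_nonneg _; linarith)
    linarith

end ArchG3Rec

end Summit.ABC.StewartYu
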